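import Literature.AlgebraicGeometry.Motives.UniversalHypersurfaceFibre
import Literature.AlgebraicGeometry.Motives.FermatHypersurface
import Mathlib.FieldTheory.Finite.Basic
import HarnessLib

/-!
# The diagonal hypersurface `V₊(Σ βᵢ xᵢ^d) ⊂ ℙⁿ⁺¹_k` is a smooth hypersurface of dimension `n` and degree `d`
# whenever `d ≠ 0` in `k` (`n ≥ 1`); over `𝔽_q` this holds for every `d ∣ q − 1`
# (Weil 1949 «a variety (without singular points)»; Hartshorne I Ex. 5.5, I Ex. 5.8, II Example 8.20.2)

Topic `Literature/AlgebraicGeometry/Motives`; THEOREMS ONLY (no definition, no instance, no named fact;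
D-0026).  Weil 1949, p. 505: «the homogeneous equation (7) `a₀x₀ⁿ + ⋯ + a_rx_rⁿ = 0`, considered as the equation of
a variety (without singular points) in the projective space `Pʳ` over the field `k`» (held
`paper:doi-10-1090-s0002-9904-1949-09219-4` p0009; Weil's tacit hypothesis is `p ∤ n`, our `d ≠ 0` in `k`).  This
file proves the parenthesis for the tree's scheme `X = SmoothHypersurface.hypersurface (Σ C(βᵢ) xᵢ^d)`
(`Motives/SmoothHypersurfaceScheme`: `V₊(F)` with its reduced induced structure, Hartshorne II Example 3.2.6) in
the tree's vocabulary `Motives.IsSmoothHypersurface n d X` (smooth projective geometrically irreducible of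
dimension `n`, cut out by an irreducible form of degree `d`; `Motives/Sweep1`) and `Motives.IsSmoothProjective n X`:

* the Jacobian criterion (Hartshorne I Ex. 5.8, the tree's `SmoothHypersurface.IsNonsingularForm` and
  `isSmoothHypersurface_hypersurface`): `∂ᵢ(Σ βⱼxⱼ^d) = dβᵢxᵢ^{d−1}`, so a prime containing all partials contains
  every `xᵢ` as soon as `dβᵢ` is a unit (`isNonsingularForm_sum_C_mul_X_pow`; Hartshorne I Ex. 5.5 for the Fermat
  form, the tree's `isNonsingularForm_sum_X_pow`);
* irreducibility over every overfield, needed for geometric irreducibility, from the tree's Krull-height theorem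
  `IsNonsingularForm.irreducible` (a nonsingular form in `≥ 3` variables is irreducible, Hartshorne II Example
  8.20.2 via I Thm. 7.2) and `IsNonsingularForm.map` (nonsingularity survives extension of scalars) — packaged once
  and for all as **`IsNonsingularForm.isSmoothHypersurface`**: over ANY field, a nonsingular form of degree `d ≥ 1`
  in `n + 2 ≥ 3` variables cuts out a smooth hypersurface of dimension `n` and degree `d` (the tree had this over
  `ℂ`, `ShiodaKatsura1979/SplitFormsNonsingular`, and for the points of the universal family,
  `UniversalHypersurfaceFibre.isSmoothProjective_hypersurface_pointForm`).

In particular the Fermat standard model `V₊(x₀^d + ⋯ + x_{n+1}^d)` is a smooth hypersurface over every field with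
`d ≠ 0` in `k` (`isSmoothHypersurface_fermat_of_natCast_ne_zero`) — `Motives/FermatHypersurface` proved this under
the extra hypothesis `ζ^d = −1` for some `ζ ∈ k` (Eisenstein at a rational point), which Krull's theorem removes —
and over a finite field `𝔽_q` the diagonal and Fermat hypersurfaces of exponent `d ∣ q − 1` are smooth projective
of dimension `n` unconditionally (`natCast_ne_zero_of_dvd_card_sub_one`: `d ∣ q − 1 ⟹ p ∤ d`), the standing setting
of `Motives/DiagonalHypersurfacePointCount`, `…/ZetaFunctionOfDiagonalHypersurface`,
`…/WeilConjecturesForDiagonalHypersurface` (g49-#1–#3).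

## References

* [Weil1949] A. Weil, Bull. AMS 55 (1949) 497–508, p. 505 («a variety (without singular points)»).
* [Hartshorne1977] R. Hartshorne, Algebraic Geometry, GTM 52 (1977): I Ex. 5.5, I Ex. 5.8, I Thm. 7.2, II Example 3.2.6,
  II Example 8.20.2, III Example 10.0.3.
* [Shioda1979PJA] T. Shioda, Proc. Japan Acad. 55A (1979), §1 eq. (1) (the Fermat variety `Xⁿₘ(p)`, `p ∤ m`).
* [LidlNiederreiter1996] R. Lidl, H. Niederreiter, Finite Fields, Thm. 2.2 / Lemma 2.1 (`|𝔽_q| = pᵐ`).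
* Tree: `Motives/HypersurfaceFormsNonsingular` (`IsNonsingularForm`, `isNonsingularForm_sum_X_pow`),
  `Motives/SmoothHypersurfaceExistenceProofs` (`isSmoothHypersurface_hypersurface`), `Motives/NonsingularFormIrreducible`
  (`IsNonsingularForm.irreducible`), `Motives/UniversalHypersurfaceFibre` (`IsNonsingularForm.map`),
  `Motives/FermatHypersurface`.

## Provenance

Lane `lit-hodgefound` (summit `HodgeConjecture`, Track 2 foundations library, Layer B: motives / varieties over
finite fields), seat `lit-hodgefound-p29` (literature-prover, generation 49, row g49-#4).
-/

universe u

open MvPolynomial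

noncomputable section

namespace Literature.AlgebraicGeometry.Motives

namespace SmoothHypersurface

variable {k : Type u} [Field k] {n : ℕ}

/-! ### §1 A nonsingular form cuts out a smooth hypersurface, over any field -/

/-- **A nonsingular form of degree `d ≥ 1` in `n + 2 ≥ 3` variables cuts out a smooth hypersurface of dimension `n`
and degree `d`, over any field**: `V₊(F)` is smooth of relative dimension `n` (Jacobian criterion, Hartshorne I
Ex. 5.8 with III 10.0.3), projective, and geometrically irreducible because `F` stays nonsingular, hence
irreducible, over every overfield (Hartshorne II Example 8.20.2: a reducible hypersurface of `ℙᵐ`, `m ≥ 2`, is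
singular where two components meet; the tree's `IsNonsingularForm.irreducible`, `IsNonsingularForm.map`).
[cite: Hartshorne1977, I Ex. 5.8 and II Example 8.20.2] -/
theorem IsNonsingularForm.isSmoothHypersurface (hn : 1 ≤ n) {d : ℕ} (hd : 1 ≤ d) {F : MvPolynomial (Fin (n + 2)) k}
    (hF : F.IsHomogeneous d) (hJ : IsNonsingularForm k F) : IsSmoothHypersurface n d (hypersurface F) :=
  isSmoothHypersurface_hypersurface F hF hd hJ
    fun K _ _ => ((hJ.map (algebraMap k K)).irreducible hn hd (hF.map _))

/-- The same, unpacked: `V₊(F)` is smooth projective of dimension `n` and is cut out by `F`, for `F` nonsingular of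
degree `d ≥ 1` in `n + 2 ≥ 3` variables over any field. [cite: Hartshorne1977, I Ex. 5.8 and III Example 10.0.3] -/
theorem IsNonsingularForm.isSmoothProjective (hn : 1 ≤ n) {d : ℕ} (hd : 1 ≤ d) {F : MvPolynomial (Fin (n + 2)) k}
    (hF : F.IsHomogeneous d) (hJ : IsNonsingularForm k F) :
    IsSmoothProjective n (hypersurface F) ∧ IsHypersurfaceCutOutBy (n + 1) F (hypersurface F) :=
  ⟨(hJ.isSmoothHypersurface hn hd hF).1, isHypersurfaceCutOutBy_hypersurface F hF hJ hd⟩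

/-! ### §2 The diagonal form `Σ βᵢ xᵢ^d` is nonsingular for `βᵢ ≠ 0`, `d ≠ 0` in `k` -/

/-- `∂ₛ (Σᵢ βᵢxᵢᵈ) = βₛ · d · xₛ^{d−1}`. [cite: Hartshorne1977, I Ex. 5.5] -/
theorem pderiv_sum_C_mul_X_pow (β : Fin (n + 2) → k) (d : ℕ) (s : Fin (n + 2)) :
    pderiv s (∑ i : Fin (n + 2), C (β i) * (X i : MvPolynomial (Fin (n + 2)) k) ^ d) =
      C (β s) * ((d : MvPolynomial (Fin (n + 2)) k) * X s ^ (d - 1)) := by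
  rw [map_sum, Finset.sum_eq_single s (fun j _ hjs => by
      rw [pderiv_C_mul, Derivation.leibniz_pow, pderiv_X_of_ne hjs, smul_zero, smul_zero, mul_zero])
    (fun h => absurd (Finset.mem_univ s) h), pderiv_C_mul, Derivation.leibniz_pow, pderiv_X_self]
  simp [nsmul_eq_mul]

/-- **The diagonal form `Σᵢ βᵢxᵢ^d` is nonsingular when all `βᵢ ≠ 0` and `d ≠ 0` in `k`** (Weil's «variety
(without singular points)», his tacit `p ∤ n`): a prime containing `∂ᵢ = dβᵢxᵢ^{d−1}` contains `xᵢ` (`dβᵢ` is a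
unit; for `d = 1`, `1 ∈ 𝔭` is absurd) — the Jacobian criterion hypothesis of Hartshorne I Ex. 5.8, exactly as for
the Fermat form (I Ex. 5.5, the tree's `isNonsingularForm_sum_X_pow`). [cite: Weil1949, p. 505]
[cite: Hartshorne1977, I Ex. 5.5 and I Ex. 5.8] -/
theorem isNonsingularForm_sum_C_mul_X_pow {β : Fin (n + 2) → k} (hβ : ∀ i, β i ≠ 0) {d : ℕ}
    (hdk : (d : k) ≠ 0) :
    IsNonsingularForm k (∑ i : Fin (n + 2), C (β i) * (X i : MvPolynomial (Fin (n + 2)) k) ^ d) := by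
  intro 𝔭 hp _ hder i
  have h := hder i
  rw [pderiv_sum_C_mul_X_pow, ← map_natCast (C : k →+* MvPolynomial (Fin (n + 2)) k) d, ← mul_assoc,
    ← map_mul, Ideal.unit_mul_mem_iff_mem 𝔭 ((IsUnit.mk0 _ (mul_ne_zero (hβ i) hdk)).map C)] at h
  exact hp.mem_of_pow_mem _ h

/-- **The diagonal hypersurface `V₊(Σ βᵢxᵢ^d) ⊂ ℙⁿ⁺¹_k` is a smooth hypersurface of dimension `n` and degree `d`**
for units `βᵢ`, `n ≥ 1`, `d ≥ 1` and `d ≠ 0` in `k` (Weil 1949 p. 505 «a variety (without singular points)»;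
Jacobian criterion + Krull for geometric irreducibility). [cite: Weil1949, p. 505]
[cite: Hartshorne1977, I Ex. 5.8 and II Example 8.20.2] -/
theorem isSmoothHypersurface_diagonalHypersurface (hn : 1 ≤ n) {d : ℕ} (hd : 1 ≤ d) (hdk : (d : k) ≠ 0)
    (β : Fin (n + 2) → kˣ) :
    IsSmoothHypersurface n d
      (hypersurface (∑ i, C (β i : k) * X i ^ d : MvPolynomial (Fin (n + 2)) k)) :=
  (isNonsingularForm_sum_C_mul_X_pow (fun i => (β i).ne_zero) hdk).isSmoothHypersurface hn hd
    (IsHomogeneous.sum _ _ _ fun i _ => (isHomogeneous_X_pow i d).C_mul _)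

/-- The diagonal hypersurface is smooth projective of dimension `n` (`n ≥ 1`, `d ≥ 1`, `d ≠ 0` in `k`, units
`βᵢ`) — the hypothesis `IsSmoothProjective n X` of the tree's Weil-cohomology machinery. [cite: Weil1949, p. 505]
[cite: Hartshorne1977, I Ex. 5.8 and III Example 10.0.3] -/
theorem isSmoothProjective_diagonalHypersurface (hn : 1 ≤ n) {d : ℕ} (hd : 1 ≤ d) (hdk : (d : k) ≠ 0)
    (β : Fin (n + 2) → kˣ) :
    IsSmoothProjective n (hypersurface (∑ i, C (β i : k) * X i ^ d : MvPolynomial (Fin (n + 2)) k)) :=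
  (isSmoothHypersurface_diagonalHypersurface hn hd hdk β).1

/-- **The Fermat standard model `V₊(x₀^d + ⋯ + x_{n+1}^d)` is a smooth hypersurface of dimension `n` and degree `d`
over EVERY field in which `d ≠ 0`** (`n ≥ 1`, `d ≥ 1`) — Shioda's standing hypothesis `p ∤ m` for `Xⁿₘ(p)` and
nothing else: the hypothesis `ζ^d = −1` of `isSmoothHypersurface_hypersurface_fermatPolynomial`
(`Motives/FermatHypersurface`, Eisenstein at a rational point) is removed by the Krull-height irreducibility of
nonsingular forms. [cite: Shioda1979PJA, §1 eq. (1)] [cite: Hartshorne1977, I Ex. 5.5 and II Example 8.20.2] -/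
theorem isSmoothHypersurface_fermat_of_natCast_ne_zero (hn : 1 ≤ n) {d : ℕ} (hd : 1 ≤ d) (hdk : (d : k) ≠ 0) :
    IsSmoothHypersurface n d (hypersurface (fermatPolynomial k n d)) :=
  (isNonsingularForm_sum_X_pow hdk).isSmoothHypersurface hn hd (isHomogeneous_fermatPolynomial n d)

/-- The Fermat standard model is smooth projective of dimension `n` over every field with `d ≠ 0` in `k`
(`n ≥ 1`, `d ≥ 1`). [cite: Shioda1979PJA, §1 eq. (1)] [cite: Hartshorne1977, I Ex. 5.5 and III Example 10.0.3] -/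
theorem isSmoothProjective_fermat_of_natCast_ne_zero (hn : 1 ≤ n) {d : ℕ} (hd : 1 ≤ d) (hdk : (d : k) ≠ 0) :
    IsSmoothProjective n (hypersurface (fermatPolynomial k n d)) :=
  (isSmoothHypersurface_fermat_of_natCast_ne_zero hn hd hdk).1

/-- An abstract Fermat variety `Xⁿ_d` over a field with `d ≠ 0` in `k` (`n ≥ 1`, `d ≥ 1`) which is smooth
projective of dimension `n` is a smooth hypersurface of degree `d` — without the `ζ^d = −1` hypothesis of
`IsFermatVariety.isSmoothHypersurface`. [cite: Shioda1979PJA, §1 eq. (1)] [cite: Hartshorne1977, II Example 8.20.2] -/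
theorem _root_.Literature.AlgebraicGeometry.Motives.IsFermatVariety.isSmoothHypersurface_of_natCast_ne_zero
    {X : SchemeOver k} {d : ℕ} (hF : IsFermatVariety n d X) (hX : IsSmoothProjective n X) (hn : 1 ≤ n)
    (hd : 1 ≤ d) (hdk : (d : k) ≠ 0) : IsSmoothHypersurface n d X :=
  ⟨hX, fermatPolynomial k n d, isHomogeneous_fermatPolynomial n d,
    (isNonsingularForm_sum_X_pow hdk).irreducible hn hd (isHomogeneous_fermatPolynomial n d), hF⟩

/-! ### §3 Over a finite field: `d ∣ q − 1` suffices -/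

section FiniteField

variable [Finite k]

/-- **`d ∣ q − 1 ⟹ d ≠ 0` in `𝔽_q`**: `q = pᵐ` (`m ≥ 1`), so `p ∣ d` together with `d ∣ q − 1` would give
`p ∣ 1`. (Lidl–Niederreiter Thm. 2.2: a finite field has `pᵐ` elements, `p` its characteristic.)
[cite: LidlNiederreiter1996, Lemma 2.1 and Thm. 2.2] -/
theorem natCast_ne_zero_of_dvd_card_sub_one {d : ℕ} (hd : d ∣ Nat.card k - 1) : (d : k) ≠ 0 := by
  letI := Fintype.ofFinite k
  have hq : 1 < Nat.card k := Finite.one_lt_card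
  intro h0
  have hp := (CharP.cast_eq_zero_iff k (ringChar k) d).mp h0
  obtain ⟨m, hprime, hcard⟩ := FiniteField.card k (ringChar k)
  rw [Fintype.card_eq_nat_card] at hcard
  have h1 : ringChar k ∣ Nat.card k := by
    rw [hcard]
    exact dvd_pow_self _ (PNat.ne_zero m)
  have h2 : ringChar k ∣ Nat.card k - (Nat.card k - 1) := Nat.dvd_sub h1 (hp.trans hd)
  rw [show Nat.card k - (Nat.card k - 1) = 1 by omega, Nat.dvd_one] at h2
  exact hprime.one_lt.ne' h2

/-- `d ∣ q − 1 ⟹ 1 ≤ d`. [cite: LidlNiederreiter1996, Thm. 2.2] -/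
theorem one_le_of_dvd_card_sub_one {d : ℕ} (hd : d ∣ Nat.card k - 1) : 1 ≤ d := by
  refine Nat.pos_of_ne_zero ?_
  rintro rfl
  rw [zero_dvd_iff] at hd
  have := Finite.one_lt_card (α := k)
  omega

/-- **Over `𝔽_q`, the diagonal hypersurface `V₊(Σ βᵢxᵢ^d) ⊂ ℙⁿ⁺¹` with `d ∣ q − 1`, `n ≥ 1`, units `βᵢ`, is a
smooth hypersurface of dimension `n` and degree `d`** — the setting of Weil 1949 §«(7)» and Ireland–Rosen
Ch. 10 §3 / Ch. 11 §3 (`q ≡ 1 (m)`). [cite: Weil1949, p. 505] [cite: Hartshorne1977, I Ex. 5.8 and II Example 8.20.2] -/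
theorem isSmoothHypersurface_diagonalHypersurface_of_dvd (hn : 1 ≤ n) {d : ℕ} (hd : d ∣ Nat.card k - 1)
    (β : Fin (n + 2) → kˣ) :
    IsSmoothHypersurface n d
      (hypersurface (∑ i, C (β i : k) * X i ^ d : MvPolynomial (Fin (n + 2)) k)) :=
  isSmoothHypersurface_diagonalHypersurface hn (one_le_of_dvd_card_sub_one hd)
    (natCast_ne_zero_of_dvd_card_sub_one hd) β

/-- Over `𝔽_q` with `d ∣ q − 1`, `n ≥ 1`: the diagonal hypersurface is smooth projective of dimension `n`.
[cite: Weil1949, p. 505] [cite: Hartshorne1977, I Ex. 5.8 and III Example 10.0.3] -/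
theorem isSmoothProjective_diagonalHypersurface_of_dvd (hn : 1 ≤ n) {d : ℕ} (hd : d ∣ Nat.card k - 1)
    (β : Fin (n + 2) → kˣ) :
    IsSmoothProjective n (hypersurface (∑ i, C (β i : k) * X i ^ d : MvPolynomial (Fin (n + 2)) k)) :=
  (isSmoothHypersurface_diagonalHypersurface_of_dvd hn hd β).1

/-- Over `𝔽_q` with `d ∣ q − 1`, `n ≥ 1`: the Fermat standard model `V₊(Σ xᵢ^d)` is a smooth hypersurface of
dimension `n` and degree `d` (Deligne 1982 §7: `q = N𝔭 ≡ 1 (d)`, good reduction of the Fermat hypersurface at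
`𝔭 ∤ d`). [cite: Deligne1982HodgeCycles, §7, before Lemma 7.9] [cite: Shioda1979PJA, §1 eq. (1)] -/
theorem isSmoothHypersurface_fermat_of_dvd (hn : 1 ≤ n) {d : ℕ} (hd : d ∣ Nat.card k - 1) :
    IsSmoothHypersurface n d (hypersurface (fermatPolynomial k n d)) :=
  isSmoothHypersurface_fermat_of_natCast_ne_zero hn (one_le_of_dvd_card_sub_one hd)
    (natCast_ne_zero_of_dvd_card_sub_one hd)

/-- Over `𝔽_q` with `d ∣ q − 1`, `n ≥ 1`: the Fermat standard model is smooth projective of dimension `n`.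
[cite: Deligne1982HodgeCycles, §7, before Lemma 7.9] [cite: Hartshorne1977, I Ex. 5.5] -/
theorem isSmoothProjective_fermat_of_dvd (hn : 1 ≤ n) {d : ℕ} (hd : d ∣ Nat.card k - 1) :
    IsSmoothProjective n (hypersurface (fermatPolynomial k n d)) :=
  (isSmoothHypersurface_fermat_of_dvd hn hd).1

end FiniteField

end SmoothHypersurface

end Literature.AlgebraicGeometry.Motives
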